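import Summits.CriticalPhenomena.PercolationContinuityZ3.Theorems.PercNearOneGluingNoHeavyQuantGluedPairSDEC
import HarnessLib

/-!
# QUANT lane R8, T-DEC: A DEPTH-1 SIBLING WITH THE LARGER ROOT GATE ADJOINS TO ANY SINGLE TREE FOR FREE — the width-2 forest
# `gate ρ₁ q₁ ∗ gate ρ₂ q₂` with `ρ₁` a blob-hull law and `q₂ ≤ q₁` is SDEC at `min(q₁y₁, q₂w)` from SDEC of `ρ₂` at `w` ALONE
# (prim-quant-census-2 gen 79)

builds on p205010 (kernel theorem, internal audit signed; external expert review pending)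

Support file (`--supports stmt-CriticalPhenomena-4575`), QUANT lane census seat prim-quant-census-2 (gen 79); memo
`run/shared/lean/prim/quant/prim-quant-census-2-g79/GLUEDPAIR-G79.md` §5.  Theorems only, standard axioms, no sorries, no definitions.

The two-root identity (`sdec_twoRoot_of_opened`, arm-1 g45) opens the HEAVIER root: its third input is the opened forest `ρ₁ ∗ gate_{q₂/q₁} ρ₂`.  When the
heavier-rooted sibling is depth-1 (`ρ₁ ∈ K_{y₁}(m₁)`, `y₁M₁ ≤ m₁`) that input needs NOTHING about `ρ₂` beyond SDEC + affordability at some floor `w`: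
`gate_{q₂/q₁}ρ₂` is SDEC at `(q₂/q₁)w` (`sdec_gate`) and joining the blob-hull law `ρ₁` keeps SDEC (`sdec_lconv_inBlobHull`).  So (`…QuantGluedPairSDEC` had both
siblings depth-1):
* **`sdec_two_heavyRootDepthOne`** — `ρ₁ ∈ K_{y₁}(m₁)` on `{0..M₁}` (`0 < y₁ < 1`, `y₁M₁ ≤ m₁`), `ρ₂` ANY probability law on `{0..M₂}` SDEC at `w ∈ (0,1)` and
  top-affordable there, root gates `0 < q₂ ≤ q₁ < 1`, floor `0 < x ≤ min(q₁y₁, q₂w)` ⟹ `SDEC x (M₁+M₂) (gate ρ₁ q₁ ∗ gate ρ₂ q₂)` (and `…'`: the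
  commuted product).  For a tree-built `ρ₂` this is ONE oracle call instead of two; for the kernel families (2-chains, 3-chains, glued siblings, width-2 depth-1
  forests, blob-hull laws, census-1's hubs …) it is oracle-free.
* **`sdec_depthOne_cons_depthTwo`** — instance: `ρ₂ = gate σ_a c_a ∗ gate σ_b c_b` a width-2 forest of depth-1 trees (`σ ∈` blob hulls), i.e. the second
  sibling is a DEPTH-2 tree ("cherry") with the smaller root gate: fully oracle-free at `x ≤ min(q₁y₁, q₂c_a y_a, q₂c_b y_b)`.

HONEST STATUS.  Width 2; the orientation `q₂ > q₁` (deeper sibling with the LARGER root gate) needs the opened forest `ρ₂ ∗ gate ρ₁`, a genuinely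
bigger forest — not here.  `SiblingStep`, `FarTreeRow` OPEN; RATE class (log\*) / honest sentence of `run/shared/lean/prim/quant/README.md` unchanged.
[this work].  Nothing here is cited as a published result.  The gluing rows served [cite: KozmaNitzan2024, Conjecture 3 (p. 15)]; product measure
[cite: Grimmett1999, §1.3 p. 10].
-/

noncomputable section

open scoped BigOperators

namespace Summit.CriticalPhenomena.PercolationContinuityZ3.Theorems
namespace Quant
namespace LawDec

open Finset

/-- **A DEPTH-1 SIBLING WITH THE LARGER ROOT GATE BESIDE ANY SDEC TREE.**  `ρ₁ ∈ K_{y₁}(m₁)` (`InBlobHull y₁ m₁ M₁ ρ₁`, `0 < y₁ < 1`, `y₁M₁ ≤ m₁`); `ρ₂` a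
probability law on `{0..M₂}`, SDEC at `0 < w < 1` with `w·M₂ ≤ mean ρ₂`; `0 < q₂ ≤ q₁ < 1`; `0 < x ≤ q₁y₁`, `x ≤ q₂w` ⟹
`SDEC x (M₁+M₂) (gate ρ₁ q₁ ∗ gate ρ₂ q₂)`. [this work] -/
theorem sdec_two_heavyRootDepthOne {y₁ m₁ w q₁ q₂ x : ℝ} {M₁ M₂ : ℕ} {ρ₁ ρ₂ : ℕ → ℝ}
    (hy₁0 : 0 < y₁) (hy₁1 : y₁ < 1) (hρ₁ : InBlobHull y₁ m₁ M₁ ρ₁) (hta₁ : y₁ * (M₁ : ℝ) ≤ m₁)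
    (hw0 : 0 < w) (hw1 : w < 1) (h₂0 : ∀ h, 0 ≤ ρ₂ h) (h₂M : ∀ h, M₂ < h → ρ₂ h = 0) (h₂1 : ∑ h ∈ Finset.range (M₂ + 1), ρ₂ h = 1)
    (hta₂ : w * (M₂ : ℝ) ≤ ∑ h ∈ Finset.range (M₂ + 1), (h : ℝ) * ρ₂ h) (hS₂ : SDEC w M₂ ρ₂)
    (hq₂0 : 0 < q₂) (hq : q₂ ≤ q₁) (hq₁1 : q₁ < 1) (hx0 : 0 < x) (hx₁ : x ≤ q₁ * y₁) (hx₂ : x ≤ q₂ * w) :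
    SDEC x (M₁ + M₂) (lconv M₁ M₂ (gate ρ₁ q₁) (gate ρ₂ q₂)) := by
  have hq₁0 : 0 < q₁ := lt_of_lt_of_le hq₂0 hq
  obtain ⟨a0, aM, a1⟩ := hρ₁.lawFacts hy₁0.le
  have amn := hρ₁.mean_eq
  have hS₁ : SDEC y₁ M₁ ρ₁ := sdec_of_inBlobHull hy₁0 hy₁1 hρ₁
  -- opened floor
  set v : ℝ := x / q₁ with hv
  have hv0 : 0 < v := div_pos hx0 hq₁0
  have hvy₁ : v ≤ y₁ := by rw [hv, div_le_iff₀ hq₁0]; linarith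
  have hv1 : v < 1 := lt_of_le_of_lt hvy₁ hy₁1
  have hxv : x ≤ q₁ * v := by rw [hv, mul_div_cancel₀ _ hq₁0.ne']
  -- the opened second sibling at v
  set q' : ℝ := q₂ / q₁ with hq'
  have hq'0 : 0 < q' := div_pos hq₂0 hq₁0
  have hq'1 : q' ≤ 1 := (div_le_one hq₁0).2 hq
  have hρ₂' : SDEC (x / q₂) M₂ ρ₂ := sdec_mono hS₂ (by rw [div_le_iff₀ hq₂0]; linarith) hw1
  have ht' : SDEC v M₂ (gate ρ₂ q') := by
    have := sdec_gate hρ₂' q' hq'0 hq'1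
    have e : q' * (x / q₂) = v := by rw [hq', hv]; field_simp
    rwa [e] at this
  obtain ⟨u0, uM, u1⟩ := gate_laws M₂ ρ₂ q' hq'0.le hq'1 h₂0 h₂M h₂1
  have hvq' : v ≤ q' * w := by
    rw [hv, hq', div_mul_eq_mul_div, div_le_div_iff_of_pos_right hq₁0]; exact hx₂
  have hta' : v * (M₂ : ℝ) ≤ ∑ h ∈ Finset.range (M₂ + 1), (h : ℝ) * gate ρ₂ q' h := by
    rw [sum_mul_gate]
    have h1 : v * (M₂ : ℝ) ≤ q' * w * M₂ := mul_le_mul_of_nonneg_right hvq' (Nat.cast_nonneg M₂)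
    have h2 : q' * (w * (M₂ : ℝ)) ≤ q' * ∑ h ∈ Finset.range (M₂ + 1), (h : ℝ) * ρ₂ h := mul_le_mul_of_nonneg_left hta₂ hq'0.le
    have e : q' * w * (M₂ : ℝ) = q' * (w * (M₂ : ℝ)) := by ring
    linarith
  have hG : SDEC v (M₁ + M₂) (lconv M₁ M₂ ρ₁ (gate ρ₂ (q₂ / q₁))) := by
    have := sdec_lconv_inBlobHull hv0 hv1 u0 uM u1 hta' ht' (hρ₁.mono hvy₁ le_rfl)
    rw [lconv_comm, Nat.add_comm M₂ M₁] at this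
    rw [← hq']; exact this
  exact sdec_twoRoot_of_opened y₁ w v x q₁ q₂ M₁ M₂ ρ₁ ρ₂ hy₁0 hy₁1 hw0 hw1 hv0.le hv1 hq₂0 hq hq₁1 hx0
    a0 aM a1 (by rw [amn]; exact hta₁) h₂0 h₂M h₂1 hta₂ hS₁ hS₂ hG hx₁ hx₂ hxv

/-- the commuted form: `SDEC x (M₂+M₁) (gate ρ₂ q₂ ∗ gate ρ₁ q₁)`. [this work] -/
theorem sdec_two_heavyRootDepthOne' {y₁ m₁ w q₁ q₂ x : ℝ} {M₁ M₂ : ℕ} {ρ₁ ρ₂ : ℕ → ℝ}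
    (hy₁0 : 0 < y₁) (hy₁1 : y₁ < 1) (hρ₁ : InBlobHull y₁ m₁ M₁ ρ₁) (hta₁ : y₁ * (M₁ : ℝ) ≤ m₁)
    (hw0 : 0 < w) (hw1 : w < 1) (h₂0 : ∀ h, 0 ≤ ρ₂ h) (h₂M : ∀ h, M₂ < h → ρ₂ h = 0) (h₂1 : ∑ h ∈ Finset.range (M₂ + 1), ρ₂ h = 1)
    (hta₂ : w * (M₂ : ℝ) ≤ ∑ h ∈ Finset.range (M₂ + 1), (h : ℝ) * ρ₂ h) (hS₂ : SDEC w M₂ ρ₂)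
    (hq₂0 : 0 < q₂) (hq : q₂ ≤ q₁) (hq₁1 : q₁ < 1) (hx0 : 0 < x) (hx₁ : x ≤ q₁ * y₁) (hx₂ : x ≤ q₂ * w) :
    SDEC x (M₂ + M₁) (lconv M₂ M₁ (gate ρ₂ q₂) (gate ρ₁ q₁)) := by
  have := sdec_two_heavyRootDepthOne hy₁0 hy₁1 hρ₁ hta₁ hw0 hw1 h₂0 h₂M h₂1 hta₂ hS₂ hq₂0 hq hq₁1 hx0 hx₁ hx₂
  rwa [lconv_comm, Nat.add_comm M₁ M₂] at this

/-- **A DEPTH-1 SIBLING BESIDE A DEPTH-2 "CHERRY" WITH THE SMALLER ROOT GATE — ORACLE-FREE.**  `ρ₁ ∈ K_{y₁}(m₁)` (`y₁M₁ ≤ m₁`); the second sibling's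
sub-forest is a width-2 forest of depth-1 trees `gate σa ca ∗ gate σb cb` (`σa ∈ K_{ya}(ma)`, `σb ∈ K_{yb}(mb)`, `ya·Ma ≤ ma`, `yb·Mb ≤ mb`,
`0 < ca, cb < 1`); root gates `0 < q₂ ≤ q₁ < 1`; floor `0 < x ≤ q₁y₁`, `x ≤ q₂·ca·ya`, `x ≤ q₂·cb·yb` ⟹
`SDEC x (M₁ + (Ma+Mb)) (gate ρ₁ q₁ ∗ gate (gate σa ca ∗ gate σb cb) q₂)`. [this work] -/
theorem sdec_depthOne_cons_depthTwo {y₁ m₁ ya ma yb mb ca cb q₁ q₂ x : ℝ} {M₁ Ma Mb : ℕ} {ρ₁ σa σb : ℕ → ℝ}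
    (hy₁0 : 0 < y₁) (hy₁1 : y₁ < 1) (hρ₁ : InBlobHull y₁ m₁ M₁ ρ₁) (hta₁ : y₁ * (M₁ : ℝ) ≤ m₁)
    (hya0 : 0 < ya) (hya1 : ya < 1) (hyb0 : 0 < yb) (hyb1 : yb < 1)
    (hσa : InBlobHull ya ma Ma σa) (hσb : InBlobHull yb mb Mb σb) (htaa : ya * (Ma : ℝ) ≤ ma) (htab : yb * (Mb : ℝ) ≤ mb)
    (hca0 : 0 < ca) (hca1 : ca < 1) (hcb0 : 0 < cb) (hcb1 : cb < 1)
    (hq₂0 : 0 < q₂) (hq : q₂ ≤ q₁) (hq₁1 : q₁ < 1) (hx0 : 0 < x) (hx₁ : x ≤ q₁ * y₁)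
    (hxa : x ≤ q₂ * (ca * ya)) (hxb : x ≤ q₂ * (cb * yb)) :
    SDEC x (M₁ + (Ma + Mb)) (lconv M₁ (Ma + Mb) (gate ρ₁ q₁) (gate (lconv Ma Mb (gate σa ca) (gate σb cb)) q₂)) := by
  -- the cherry's sub-forest is SDEC at w = min-type floor x/q₂ ≤ min(ca ya, cb yb)
  set w : ℝ := x / q₂ with hw
  have hw0 : 0 < w := div_pos hx0 hq₂0
  have hwa : w ≤ ca * ya := by rw [hw, div_le_iff₀ hq₂0]; linarith
  have hwb : w ≤ cb * yb := by rw [hw, div_le_iff₀ hq₂0]; linarith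
  have hw1 : w < 1 := by
    have : ca * ya < 1 := by nlinarith
    linarith
  have hF : SDEC w (Ma + Mb) (lconv Ma Mb (gate σa ca) (gate σb cb)) :=
    sdec_two_of_subBlobHull hya0 hya1 hyb0 hyb1 hca0 hca1 hcb0 hcb1 hσa hσb htaa htab hw0 hwa hwb
  -- law facts of the cherry's sub-forest
  obtain ⟨sa0, saM, sa1⟩ := hσa.lawFacts hya0.le
  obtain ⟨sb0, sbM, sb1⟩ := hσb.lawFacts hyb0.le
  obtain ⟨ua0, uaM, ua1⟩ := gate_laws Ma σa ca hca0.le hca1.le sa0 saM sa1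
  obtain ⟨ub0, ubM, ub1⟩ := gate_laws Mb σb cb hcb0.le hcb1.le sb0 sbM sb1
  have f0 : ∀ h, 0 ≤ lconv Ma Mb (gate σa ca) (gate σb cb) h := lconv_nonneg _ _ _ _ ua0 ub0
  have fM : ∀ h, Ma + Mb < h → lconv Ma Mb (gate σa ca) (gate σb cb) h = 0 := fun h hh => lconv_eq_zero _ _ _ _ h hh
  have f1 : ∑ h ∈ Finset.range (Ma + Mb + 1), lconv Ma Mb (gate σa ca) (gate σb cb) h = 1 := sum_lconv _ _ _ _ ua1 ub1
  have fmn : ∑ h ∈ Finset.range (Ma + Mb + 1), (h : ℝ) * lconv Ma Mb (gate σa ca) (gate σb cb) h = ca * ma + cb * mb := by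
    rw [sum_mul_lconv _ _ _ _ ua1 ub1, sum_mul_gate, sum_mul_gate, hσa.mean_eq, hσb.mean_eq]
  have hta₂ : w * ((Ma + Mb : ℕ) : ℝ) ≤ ∑ h ∈ Finset.range (Ma + Mb + 1), (h : ℝ) * lconv Ma Mb (gate σa ca) (gate σb cb) h := by
    rw [fmn]
    have h1 : w * (Ma : ℝ) ≤ ca * ya * Ma := mul_le_mul_of_nonneg_right hwa (Nat.cast_nonneg Ma)
    have h2 : w * (Mb : ℝ) ≤ cb * yb * Mb := mul_le_mul_of_nonneg_right hwb (Nat.cast_nonneg Mb)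
    have h3 : ca * (ya * (Ma : ℝ)) ≤ ca * ma := mul_le_mul_of_nonneg_left htaa hca0.le
    have h4 : cb * (yb * (Mb : ℝ)) ≤ cb * mb := mul_le_mul_of_nonneg_left htab hcb0.le
    have e : w * ((Ma + Mb : ℕ) : ℝ) = w * (Ma : ℝ) + w * (Mb : ℝ) := by push_cast; ring
    have e3 : ca * ya * (Ma : ℝ) = ca * (ya * (Ma : ℝ)) := by ring
    have e4 : cb * yb * (Mb : ℝ) = cb * (yb * (Mb : ℝ)) := by ring
    rw [e]; linarith
  have hx₂ : x ≤ q₂ * w := by rw [hw, mul_div_cancel₀ _ hq₂0.ne']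
  exact sdec_two_heavyRootDepthOne hy₁0 hy₁1 hρ₁ hta₁ hw0 hw1 f0 fM f1 hta₂ hF hq₂0 hq hq₁1 hx0 hx₁ hx₂

end LawDec
end Quant
end Summit.CriticalPhenomena.PercolationContinuityZ3.Theorems
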